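import Summits.BirchSwinnertonDyer.BirchSwinnertonDyer.Theorems.ClassRecordThreeEulerHalvesAtThreeCartanCoverPrintClausesDevelopment
import Summits.BirchSwinnertonDyer.BirchSwinnertonDyer.Theorems.ClassRecordThreeEulerHalvesAtThreeCartanCoverPrintClausesDescent
import Summits.BirchSwinnertonDyer.BirchSwinnertonDyer.Theorems.ClassRecordThreeEulerHalvesAtThreeCartanCoverPrintClausesDivision
import Literature.Geometry.Kaehler.RiemannSurfaceRealPeriodsPrescribed
import Literature.NumberTheory.Automorphic.ShimuraCurveDivisionLattice
import HarnessLib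

/-!
# Crux NUM `CartanOnePlaceDegreeLawAtThree` (item 24801), line `lattice` — the print clauses X: **THE SURJECTIVITY HALF OF (ESᶜ) FOR A COCOMPACT TORSION-FREE `Γ`** —
# every additive `u : Γ → ℝ` is the real period cochain of a weight-two cusp form on `Γ` (dimension count over the compact Riemann surface `Γ∖ℍ`)

Seat `bsd-stepL-tam3-p1` g29 (LEAD of crux 24801; `--supports stmt-BirchSwinnertonDyer-24801 --as helper`). Assembly (E4 + E5 of the LEAD's roadmap) of the in-tree route to
the surjectivity half of (ESᶜ) `eichlerShimura_weightTwo_rePeriod`: for `Γ ≤ SL₂(ℝ)` acting freely and properly discontinuously on `ℍ` with COMPACT quotient and no cusps,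
let `M = Γ∖ℍ` (a compact connected `T₂` Riemann surface, `…PrintClausesQuotientSurface`), `V = Ω¹(M)` (tree `RiemannSurface.holomorphicOneForms`), `W = Hom(Γ, ℝ)`,
`S = S₂(Γ)`. Then, as REAL vector spaces: `V ↪ S` by the development pullback `ω ↦ dF_ω∕dz` (`…PrintClausesDevelopment`, injective), `S ↪ W` by the real periods
(injective: maximum principle on the compact quotient), and `dim W = dim Hom(π₁(M), ℝ) = 2g = dim V` (Mathlib `IsQuotientCoveringMap.fundamentalGroupEquiv` on the
simply connected `ℍ` — `π₁(M) ≅ Γᵐᵒᵖ` —, tree `RiemannSurface.rePeriodCharacter` ∕ `finrank_real_addMonoidHom_fundamentalGroup_real`). Hence all three dimensions agree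
and the period map `S → W` is ONTO: **`esSurj_of_compactQuotient`**. [cite: ShimuraIATAF1971, Thm. 8.4 p. 234] [cite: FarkasKra1992, III.3.4 Corollary (b)]
§ Cover: the crux's instance — for `X : CartanLevelCurveData D M C`, `D > 1`, `q` an odd prime, the principal level `Γ̄(q)` is cocompact, torsion-free and cusp-free
(`…PrintClausesQuotientSurface`, `…PrintClausesTorsionFree`), so `esSurj_of_compactQuotient` applies to it, and the descent `…PrintClausesDescent` carries surjectivity
up to the cover group `ι(O₀'¹) = coverUnits X q`: **`esSurj_coverUnits_of_one_lt`** / `esSurjClause_coverUnits_of_one_lt` = the `hESsurj` input of the line's glue at `D > 1`.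
Theorems only; nothing about NUM or any curve is proved; BSD is proved for no curve.
-/

set_option linter.dupNamespace false
set_option autoImplicit false

noncomputable section

open scoped MatrixGroups Manifold ContDiff Topology ModularForm
open Function Set Filter

namespace Summit.BirchSwinnertonDyer.BirchSwinnertonDyer.Theorems.CartanCover.PrintClauses

open Literature.NumberTheory.Automorphic
open Literature.Geometry.Manifold
open Literature.Geometry.Kaehler Literature.Geometry.Kaehler.RiemannSurface

section Surjective

variable (Γ : Subgroup (GL (Fin 2) ℝ)) [Γ.HasDetOne] [ProperlyDiscontinuousSMul Γ UpperHalfPlane] [IsCancelSMul Γ UpperHalfPlane]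

/-! ### Injectivity of the real-period map for a cocompact `Γ` (maximum principle) -/

omit [ProperlyDiscontinuousSMul Γ UpperHalfPlane] [IsCancelSMul Γ UpperHalfPlane] in
/-- `Ψ(γτ) = Ψ(τ) + ∫_{τ₀}^{γτ₀} F` for the primitive `Ψ = ∫_{τ₀}^τ F`.
-- adapted from Literature/NumberTheory/Automorphic/ShimuraCurvePeriodsHeckeIntegralityProofs.lean §2 (no hub olean in this closure) [cite: ShimuraIATAF1971, §8.2 (8.2.19)–(8.2.20)] -/
private theorem segmentIntegral_smul_eq_add_period'' (F : CuspForm Γ 2) {γ : GL (Fin 2) ℝ} (hγ : γ ∈ Γ) (τ₀ τ : UpperHalfPlane) :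
    segmentIntegral F τ₀ (γ • τ) = segmentIntegral F τ₀ τ + segmentIntegral F τ₀ (γ • τ₀) := by
  have hdet : 0 < γ.det.val := by rw [Subgroup.HasDetOne.det_eq hγ, Units.val_one]; exact one_pos
  have hinv : segmentIntegral F (γ • τ₀) (γ • τ) = segmentIntegral F τ₀ τ := by
    rw [← segmentIntegral_slash_eq F hdet τ₀ τ, SlashInvariantForm.slash_action_eqn F γ hγ]
  have e2 := segmentIntegral_sub_segmentIntegral F τ₀ (γ • τ₀) (γ • τ)
  linear_combination e2 + hinv

omit [ProperlyDiscontinuousSMul Γ UpperHalfPlane] [IsCancelSMul Γ UpperHalfPlane] in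
/-- **ES-injectivity for a cocompact `Γ`** (maximum principle for `exp ∘ ∫F` on a compact set of representatives).
-- adapted from Literature/NumberTheory/Automorphic/ShimuraCurvePeriodsHeckeIntegralityProofs.lean §3 (no hub olean in this closure) [cite: ShimuraIATAF1971, Thm. 8.4] -/
private theorem eq_zero_of_forall_rePeriod_eq_zero'' {K : Set UpperHalfPlane} (hK : IsCompact K) (hcov : ∀ τ : UpperHalfPlane, ∃ γ ∈ Γ, γ • τ ∈ K)
    (F : CuspForm Γ 2) (τ₀ : UpperHalfPlane) (H : ∀ γ : Γ, CuspForm.rePeriod F τ₀ γ = 0) : F = 0 := by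
  have H' : ∀ γ ∈ Γ, (segmentIntegral F τ₀ (γ • τ₀)).re = 0 := fun γ hγ => H ⟨γ, hγ⟩
  set Ψ : UpperHalfPlane → ℂ := segmentIntegral F τ₀ with hΨdef
  have hinv : ∀ γ ∈ Γ, ∀ τ : UpperHalfPlane, (Ψ (γ • τ)).re = (Ψ τ).re := by
    intro γ hγ τ
    rw [hΨdef, segmentIntegral_smul_eq_add_period'' Γ F hγ τ₀ τ, Complex.add_re, H' γ hγ, add_zero]
  have hderiv : ∀ z : ℂ, 0 < z.im → HasDerivAt (Ψ ∘ UpperHalfPlane.ofComplex) (F (UpperHalfPlane.ofComplex z)) z :=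
    fun z hz => hasDerivAt_segmentIntegral F τ₀ hz
  have hdiff : DifferentiableOn ℂ (Ψ ∘ UpperHalfPlane.ofComplex) {z : ℂ | 0 < z.im} := differentiableOn_segmentIntegral F τ₀
  have hΨc : Continuous Ψ := by
    have h2 : Ψ = (Ψ ∘ UpperHalfPlane.ofComplex) ∘ ((↑) : UpperHalfPlane → ℂ) := by
      funext τ; simp [UpperHalfPlane.ofComplex_apply]
    rw [h2]
    exact hdiff.continuousOn.comp_continuous UpperHalfPlane.continuous_coe fun τ => τ.im_pos
  have hKne : K.Nonempty := by
    obtain ⟨γ, -, hγ⟩ := hcov UpperHalfPlane.I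
    exact ⟨_, hγ⟩
  obtain ⟨k, hkK, hk⟩ := hK.exists_isMaxOn hKne (Complex.continuous_re.comp hΨc).continuousOn
  have hmax : ∀ τ : UpperHalfPlane, (Ψ τ).re ≤ (Ψ k).re := by
    intro τ
    obtain ⟨γ, hγ, hγτ⟩ := hcov τ
    rw [← hinv γ hγ τ]
    exact hk hγτ
  set f : ℂ → ℂ := fun z => Complex.exp ((Ψ ∘ UpperHalfPlane.ofComplex) z) with hfdef
  have hfd : DifferentiableOn ℂ f {z : ℂ | 0 < z.im} := hdiff.cexp
  have hkU : (k : ℂ) ∈ {z : ℂ | 0 < z.im} := k.im_pos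
  have hfmax : IsMaxOn (norm ∘ f) {z : ℂ | 0 < z.im} (k : ℂ) := by
    intro z hz
    simp only [Function.comp_apply, hfdef, Complex.norm_exp, Set.mem_setOf_eq]
    refine Real.exp_le_exp.mpr ?_
    rw [UpperHalfPlane.ofComplex_apply, UpperHalfPlane.ofComplex_apply_of_im_pos hz]
    exact hmax _
  have hconst := Complex.eqOn_of_isPreconnected_of_isMaxOn_norm
    (convex_halfSpace_im_gt 0).isPreconnected UpperHalfPlane.isOpen_upperHalfPlaneSet hfd hkU hfmax
  have hcoe : (⇑F : UpperHalfPlane → ℂ) = 0 := by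
    funext τ
    have hτ : 0 < (τ : ℂ).im := τ.im_pos
    have hd1 : HasDerivAt f (Complex.exp ((Ψ ∘ UpperHalfPlane.ofComplex) (τ : ℂ)) * F (UpperHalfPlane.ofComplex (τ : ℂ))) (τ : ℂ) :=
      (hderiv (τ : ℂ) hτ).cexp
    have hd2 : HasDerivAt f 0 (τ : ℂ) := by
      have hev : f =ᶠ[nhds (τ : ℂ)] fun _ => f (k : ℂ) :=
        Filter.eventuallyEq_of_mem (UpperHalfPlane.isOpen_upperHalfPlaneSet.mem_nhds hτ) hconst
      exact (hasDerivAt_const (τ : ℂ) (f (k : ℂ))).congr_of_eventuallyEq hev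
    have h0 := hd1.unique hd2
    rw [UpperHalfPlane.ofComplex_apply] at h0
    rcases mul_eq_zero.mp h0 with h1 | h1
    · exact absurd h1 (Complex.exp_ne_zero _)
    · simpa using h1
  exact DFunLike.coe_injective (hcoe.trans CuspForm.coe_zero.symm)

/-! ### The surjectivity theorem -/

/-- `Γ∖ℍ` is a complex manifold (tree `…QuotientSurface`; restated as a term to feed `haveI`). -/
private theorem isManifold'' : IsManifold 𝓘(ℂ) ω (MulAction.orbitRel.Quotient Γ UpperHalfPlane) :=
  QuotientManifold.isManifold fun γ : Γ => UpperHalfPlane.contMDiff_smul (g := (γ : GL (Fin 2) ℝ))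
    (by rw [Subgroup.HasDetOne.det_eq γ.2, Units.val_one]; exact one_pos)

/-- **THE SURJECTIVITY HALF OF (ESᶜ) FOR A COCOMPACT TORSION-FREE `Γ`.** Let `Γ ≤ SL₂(ℝ)` act freely (`IsCancelSMul`) and properly discontinuously on `ℍ`, with COMPACT
quotient `Γ∖ℍ` and no cusps. Then every additive `u : Γ → ℝ` is the real period cochain `γ ↦ Re ∫_{z₀}^{γ z₀} F` of some weight-two cusp form `F` on `Γ`. Proof: dimension
count `dim Ω¹(Γ∖ℍ) ≤ dim S₂(Γ) ≤ dim Hom(Γ, ℝ) = dim Hom(π₁(Γ∖ℍ), ℝ) = dim Ω¹(Γ∖ℍ)` over `ℝ` (development pullback injective, `…Development`; real periods injective,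
maximum principle; `π₁(Γ∖ℍ) ≅ Γᵐᵒᵖ`, Mathlib `IsQuotientCoveringMap.fundamentalGroupEquiv`; `Ω¹ ≃ Hom(π₁, ℝ)`, tree `rePeriodCharacter`), so the injective period map
is onto. [cite: ShimuraIATAF1971, Thm. 8.4 p. 234] [cite: FarkasKra1992, III.3.4 Corollary (b)] -/
theorem esSurj_of_compactQuotient [CompactSpace (MulAction.orbitRel.Quotient Γ UpperHalfPlane)] (hcusp : ∀ c : OnePoint ℝ, ¬ IsCusp c Γ)
    {K : Set UpperHalfPlane} (hK : IsCompact K) (hcov : ∀ τ : UpperHalfPlane, ∃ γ ∈ Γ, γ • τ ∈ K) (z₀ : UpperHalfPlane)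
    (u : Γ → ℝ) (hu : ∀ γ δ : Γ, u (γ * δ) = u γ + u δ) :
    ∃ F : CuspForm Γ 2, ∀ γ : Γ, CuspForm.rePeriod F z₀ γ = u γ := by
  classical
  haveI := isManifold'' Γ
  haveI : ConnectedSpace (MulAction.orbitRel.Quotient Γ UpperHalfPlane) := Quotient.instConnectedSpace
  -- notation
  set M := MulAction.orbitRel.Quotient Γ UpperHalfPlane with hM
  let proj : UpperHalfPlane → M := QuotientManifold.mk (G := Γ) (M := UpperHalfPlane)
  let x₀ : M := proj UpperHalfPlane.I
  -- `π₁(M, x₀) ≃* Γ`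
  have hq : IsQuotientCoveringMap proj Γ := isQuotientCoveringMap_proj Γ
  let e₀ : FundamentalGroup M x₀ ≃* Γᵐᵒᵖ := hq.fundamentalGroupEquiv ⟨UpperHalfPlane.I, rfl⟩
  let e : FundamentalGroup M x₀ ≃* Γ := e₀.trans (MulEquiv.inv' Γ).symm
  -- the real vector spaces
  let V := ↥(holomorphicOneForms M)
  let W := Additive Γ →+ ℝ
  let W₀ := Additive (FundamentalGroup M x₀) →+ ℝ
  -- `W ≃ₗ[ℝ] W₀` by precomposition with `e`
  let eA : Additive (FundamentalGroup M x₀) ≃+ Additive Γ := MulEquiv.toAdditive e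
  let LW : W ≃ₗ[ℝ] W₀ :=
    { toFun := fun w => w.comp eA.toAddMonoidHom
      invFun := fun w₀ => w₀.comp eA.symm.toAddMonoidHom
      map_add' := fun w w' => rfl
      map_smul' := fun c w => rfl
      left_inv := fun w => AddMonoidHom.ext fun a => by
        show w (eA (eA.symm a)) = w a
        rw [AddEquiv.apply_symm_apply]
      right_inv := fun w₀ => AddMonoidHom.ext fun a => by
        show w₀ (eA.symm (eA a)) = w₀ a
        rw [AddEquiv.symm_apply_apply] }
  -- finiteness and dimensions: `V` is finite over `ℂ`, hence over `ℝ`; `V ≃ₗ[ℝ] W₀` (tree); so `W₀`, `W` are finite with the same dimension as `V`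
  haveI : Module.Finite ℂ V := moduleFinite_holomorphicOneForms (M := M)
  haveI : Module.Finite ℝ V := Module.Finite.trans ℂ V
  let RC : V ≃ₗ[ℝ] W₀ := rePeriodCharacter x₀
  haveI : Module.Finite ℝ W₀ := Module.Finite.equiv RC
  haveI : Module.Finite ℝ W := Module.Finite.equiv LW.symm
  have hdimVW : Module.finrank ℝ V = Module.finrank ℝ W := by rw [RC.finrank_eq, LW.finrank_eq]
  -- the period map `P : S →ₗ[ℝ] W`
  let S := CuspForm Γ 2
  let P : S →ₗ[ℝ] W :=
    { toFun := fun F =>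
        { toFun := fun a => CuspForm.rePeriod F z₀ (Additive.toMul a)
          map_zero' := by
            change CuspForm.rePeriod F z₀ 1 = 0
            have h := CuspForm.rePeriod_mul F z₀ 1 1
            rw [mul_one] at h; linarith
          map_add' := fun a b => by
            change CuspForm.rePeriod F z₀ (Additive.toMul a * Additive.toMul b) = _
            rw [CuspForm.rePeriod_mul] }
      map_add' := fun F G => by
        ext a
        exact CuspForm.rePeriod_add F G z₀ _
      map_smul' := fun c F => by
        ext a
        show CuspForm.rePeriod (c • F) z₀ (Additive.toMul a) = c • CuspForm.rePeriod F z₀ (Additive.toMul a)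
        rw [CuspForm.rePeriod_smul, smul_eq_mul] }
  have hPinj : Function.Injective P := by
    refine (injective_iff_map_eq_zero P).mpr fun F hF => ?_
    refine eq_zero_of_forall_rePeriod_eq_zero'' Γ hK hcov F z₀ fun γ => ?_
    exact DFunLike.congr_fun hF (Additive.ofMul γ)
  haveI : Module.Finite ℝ S := Module.Finite.of_injective P hPinj
  -- the development pullback `D : V →ₗ[ℝ] S`
  have hdev : ∀ θ : V, ∃ Fd : UpperHalfPlane → ℂ, (θ : MeromorphicOneForm M).IsDevelopment proj Fd ∧ Fd UpperHalfPlane.I = 0 :=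
    fun θ => exists_isDevelopment_proj (mem_holomorphicOneForms_iff.mp θ.2)
  choose dev hdev hdev0 using hdev
  -- developments chosen for sums / scalar multiples differ from the sum / multiple by a constant; derivatives agree
  have hderiv_eq : ∀ {θ : MeromorphicOneForm M} {F₁ F₂ : UpperHalfPlane → ℂ}, θ.IsDevelopment proj F₁ → θ.IsDevelopment proj F₂ →
      devDeriv F₁ = devDeriv F₂ := by
    intro θ F₁ F₂ h₁ h₂
    obtain ⟨c, hc⟩ := h₁.exists_eq_add_const h₂ (continuous_proj Γ)
    funext τ
    have e1 : F₂ ∘ UpperHalfPlane.ofComplex = fun z => (F₁ ∘ UpperHalfPlane.ofComplex) z + c := by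
      funext z; simp [hc]
    simp only [devDeriv, e1, deriv_add_const]
  let D : V →ₗ[ℝ] S :=
    { toFun := fun θ => cuspFormOfDevelopment hcusp (hdev θ)
      map_add' := fun θ₁ θ₂ => by
        apply DFunLike.coe_injective
        change devDeriv (dev (θ₁ + θ₂)) = fun τ => devDeriv (dev θ₁) τ + devDeriv (dev θ₂) τ
        rw [← devDeriv_add (hdev θ₁) (hdev θ₂)]
        have hsum : ((θ₁ + θ₂ : V) : MeromorphicOneForm M).IsDevelopment proj (fun τ => dev θ₁ τ + dev θ₂ τ) := by
          have h := (hdev θ₁).add (hdev θ₂)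
          exact h
        exact hderiv_eq (hdev (θ₁ + θ₂)) hsum
      map_smul' := fun c θ => by
        apply DFunLike.coe_injective
        change devDeriv (dev (c • θ)) = ⇑(c • cuspFormOfDevelopment hcusp (hdev θ))
        have hcoe : (⇑(c • cuspFormOfDevelopment hcusp (hdev θ)) : UpperHalfPlane → ℂ) = fun τ => (c : ℂ) * devDeriv (dev θ) τ := by
          funext τ
          rw [CuspForm.smul_apply, coe_cuspFormOfDevelopment, Complex.real_smul]
        rw [hcoe, ← devDeriv_const_mul (hdev θ) (c : ℂ)]
        have hsm : ((c • θ : V) : MeromorphicOneForm M).IsDevelopment proj (fun τ => (c : ℂ) * dev θ τ) := by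
          have h := (hdev θ).smul (c : ℂ)
          have e2 : ((c • θ : V) : MeromorphicOneForm M) = (c : ℂ) • (θ : MeromorphicOneForm M) := by
            rw [Submodule.coe_smul_of_tower, Complex.coe_smul]
          rw [e2]; exact h
        exact hderiv_eq (hdev (c • θ)) hsm }
  have hDinj : Function.Injective D := by
    refine (injective_iff_map_eq_zero D).mpr fun θ hθ => ?_
    have h := eq_zero_of_cuspFormOfDevelopment_eq_zero hcusp (mem_holomorphicOneForms_iff.mp θ.2) (hdev θ) hθ
    exact Subtype.ext h
  -- dimension count
  have h1 : Module.finrank ℝ V ≤ Module.finrank ℝ S := LinearMap.finrank_le_finrank_of_injective hDinj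
  have h2 : Module.finrank ℝ S ≤ Module.finrank ℝ W := LinearMap.finrank_le_finrank_of_injective hPinj
  have hSW : Module.finrank ℝ S = Module.finrank ℝ W := le_antisymm h2 (hdimVW ▸ h1)
  have hPsurj : Function.Surjective P := (LinearMap.injective_iff_surjective_of_finrank_eq_finrank hSW).mp hPinj
  -- conclude
  let w : W :=
    { toFun := fun a => u (Additive.toMul a)
      map_zero' := by
        change u 1 = 0
        have h := hu 1 1; rw [mul_one] at h; linarith
      map_add' := fun a b => hu _ _ }
  obtain ⟨F, hF⟩ := hPsurj w
  exact ⟨F, fun γ => DFunLike.congr_fun hF (Additive.ofMul γ)⟩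

end Surjective

/-! ### The crux's instance: (ESᶜ)-surjectivity for the cover groups `ι(O₀'¹)` at `D > 1` -/

section Cover

variable {D M : ℕ} {C : Finset ℕ} (X : CartanLevelCurveData D M C) (q : ℕ)

/-- `X.B` is a division algebra for `D > 1` (tree `ShimuraCurveData.isUnit_of_ne_zero` through the hull datum). -/
private theorem isUnit_of_ne_zero_of_one_lt' (hD : 1 < D) (x : X.B) (hx : x ≠ 0) : IsUnit x := by
  obtain ⟨fd₀, h₀⟩ := CartanTransport.Hull.exists_isHypFundamentalDomain_hull X
  exact (X.toShimuraCurveData fd₀ h₀).isUnit_of_ne_zero hD x hx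

/-- `Γ̄(q)` has no cusps for `D > 1` (no parabolic elements in the cover group of a division algebra). -/
theorem not_isCusp_principalLevel_of_one_lt (hD : 1 < D) (c : OnePoint ℝ) : ¬ IsCusp c (principalLevel X q) := fun hc =>
  not_isCusp_normOneUnits X.ι (isOrder_coverOrder X q) X.ι_injective (isUnit_of_ne_zero_of_one_lt' X hD) c
    (hc.mono (principalLevel_le_coverUnits X q))

/-- **(ESᶜ)-SURJECTIVITY ON THE PRINCIPAL LEVEL `Γ̄(q)`, `q` an odd prime, `D > 1`**: every additive `u₁ : Γ̄(q) → ℝ` is a real period cochain of a weight-two form on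
`Γ̄(q)` (`esSurj_of_compactQuotient` on the compact Riemann surface `Γ̄(q)∖ℍ` of `…PrintClausesQuotientSurface`). [cite: ShimuraIATAF1971, Thm. 8.4 p. 234] -/
theorem esSurj_principalLevel_of_one_lt (hq : q.Prime) (hq2 : q ≠ 2) (hD : 1 < D) (z₀ : UpperHalfPlane) (u₁ : principalLevel X q → ℝ)
    (hu₁ : ∀ γ δ : principalLevel X q, u₁ (γ * δ) = u₁ γ + u₁ δ) :
    ∃ F₁ : CuspForm (principalLevel X q) 2, ∀ γ : principalLevel X q, CuspForm.rePeriod F₁ z₀ γ = u₁ γ := by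
  haveI := properlyDiscontinuousSMul_principalLevel X q
  haveI := isCancelSMul_principalLevel X q hq hq2
  haveI := compactSpace_principalLevelQuotient_of_one_lt X q hD hq.ne_zero
  obtain ⟨K, hK, hcov⟩ := principalLevel_exists_isCompact_reps_of_one_lt X q hD hq.ne_zero
  exact esSurj_of_compactQuotient (principalLevel X q) (not_isCusp_principalLevel_of_one_lt X q hD) hK hcov z₀ u₁ hu₁

/-- **(ESᶜ)-SURJECTIVITY FOR THE COVER GROUP `ι(O₀'¹) = coverUnits X q`, `q` an odd prime, `D > 1`** — EXACTLY the hypothesis `hESsurj` that bsd-idea-10's glue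
`CartanCarayol.cuspidalEigenCochainLift_of_facts` extracts from (ESᶜ) at `(X.B, O₀', X.ι)` (there are no parabolic elements at `D > 1`, so the parabolic clause is vacuous):
every additive `u : ι(O₀'¹) → ℝ` is the real period cochain of a weight-two cusp form on `ι(O₀'¹)` (descent `…PrintClausesDescent` from the principal level).
With `…PrintClausesCocompact.eq_zero_of_forall_rePeriod_eq_zero_coverUnits` (injectivity) this makes (ESᶜ) A THEOREM at every instance the line consumes with `D > 1` and `q` odd.
[cite: ShimuraIATAF1971, Thm. 8.4 p. 234 and §8.1 (8.1.2)–(8.1.3)] -/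
theorem esSurj_coverUnits_of_one_lt (hq : q.Prime) (hq2 : q ≠ 2) (hD : 1 < D) (z₀ : UpperHalfPlane) (u : coverUnits X q → ℝ)
    (hu : ∀ γ δ : coverUnits X q, u (γ * δ) = u γ + u δ) :
    ∃ F : CuspForm (coverUnits X q) 2, ∀ γ : coverUnits X q, CuspForm.rePeriod F z₀ γ = u γ :=
  esSurj_coverUnits_of_esSurj_principalLevel (X := X) (q := q) hq.ne_zero z₀ (fun u₁ hu₁ => esSurj_principalLevel_of_one_lt X q hq hq2 hD z₀ u₁ hu₁) u hu

/-- **The surjectivity conjunct of (ESᶜ) in its printed shape** (with the — here vacuous — parabolic-null hypothesis) for the cover group, `q` odd prime, `D > 1`.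
[cite: ShimuraIATAF1971, Thm. 8.4 p. 234] -/
theorem esSurjClause_coverUnits_of_one_lt (hq : q.Prime) (hq2 : q ≠ 2) (hD : 1 < D) (z₀ : UpperHalfPlane) :
    ∀ u : coverUnits X q → ℝ,
      (∀ γ δ : coverUnits X q, u (γ * δ) = u γ + u δ) →
      (∀ γ : coverUnits X q, (γ : GL (Fin 2) ℝ).IsParabolic → u γ = 0) →
      ∃ F : CuspForm (coverUnits X q) 2, ∀ γ : coverUnits X q, CuspForm.rePeriod F z₀ γ = u γ :=
  fun u hu _ => esSurj_coverUnits_of_one_lt X q hq hq2 hD z₀ u hu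

end Cover

end Summit.BirchSwinnertonDyer.BirchSwinnertonDyer.Theorems.CartanCover.PrintClauses

end
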